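import Mathlib
import Summits.Ventures.PercRepro2.Defs
import Summits.Ventures.PercRepro2.Graph
import Summits.Ventures.PercRepro2.OneColourSwitch
import Summits.Ventures.PercRepro2.RegionHubSign
import Summits.Ventures.PercRepro2.SideSwitch
import Summits.Ventures.PercRepro2.SideSwitchComps
import Summits.Ventures.PercRepro2.M9NoPocketDefs
import Summits.Ventures.PercRepro2.M9Unreached
import Summits.Ventures.PercRepro2.M9PocketRSEdgeTransfer
import Summits.Ventures.PercRepro2.M9PocketRootOnlyTransfer
import Summits.Ventures.PercRepro2.M9PocketRootOnlySum

/-!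
# `{r, s}` separates `d` from `{p, q}` ⇒ `dSignSum ≤ 0` (blind cell PercRepro2, p3 g41,
2026-08-29; `proofs/P3-POCKETRK.md` §10⁵ (g): the root-only factorisation with `d` INSIDE the
cluster)

The factorisation of `M9PocketRootOnlySum` needs `d ∉ L` only to read `DOne` on `L`; with the
exemption of `d` written into the admissibility of `τ` («no vertex of `L` other than `d` in both
worlds of the `F`-graph», `DOne_restrict_iff_rootOnly'`) it holds for EVERY `d`
(`dSignSum_eq_mul_restrict_rootOnly'`; the count `sum_sigma_rs_glue_of_compl_iff` is proved for
any flip-invariant admissibility).  When `d ∈ L` every edge at `d` lies inside `L ∪ {r, s}`, so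
`d` is ISOLATED in `G − F` and the single-`d` sum of `G − F` is its unreached part
(`dSignSum_eq_unreachedSum_of_isolated`), which is `≤ 0` for every `d` (`unreachedSum_nonpos`).
Hence **`dSignSum_nonpos_of_rootOnly_mem`**: if a vertex set `L ∋ d` with `p, q, r, s ∉ L` is
closed under adjacency except through `r` and `s` — i.e. `{r, s}` SEPARATES `d` FROM `{p, q}`
— then `dSignSum ≤ 0`, with NO other hypothesis: linking free blocks, pockets, hubs inside `L`,
`T`-edges, edges inside `{r, s}` all arbitrary.  Own work; std axioms.
-/

namespace Summit.Ventures.PercRepro2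

namespace NoPocket

open Finset Classical OneColourSwitch SideSwitch

variable {V : Type*} {E : Type*} {ends : E → Sym2 V} {p q r s d : V} {L : Set V}

section DAnywhere

/-- **`DOne` splits, `d` anywhere**: `DOne` of the restriction together with «no vertex of `L`
other than `d` in both worlds of the `F`-graph». -/
lemma DOne_restrict_iff_rootOnly' {ω : Config E}
    (hL : ∀ e x y, ends e = s(x, y) → x ∈ L → y ∈ L ∨ y = r ∨ y = s) (hr : r ∉ L) (hs : s ∉ L) :
    DOne ends r s d ω ↔
      DOne (fun e : {e // e ∉ within ends (L ∪ {r, s} : Set V)} => ends e.1) r s d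
        (fun e => ω e.1) ∧
      ∀ x ∈ L, x ≠ d →
        x ∈ K2 (fun e : {e // ¬ (e ∉ within ends (L ∪ {r, s} : Set V))} => ends e.1) r s
          (fun e => ω e.1) →
        x ∉ M2 (fun e : {e // ¬ (e ∉ within ends (L ∪ {r, s} : Set V))} => ends e.1) r s
          (fun e => ω e.1) := by
  constructor
  · intro h
    refine ⟨?_, ?_⟩
    · intro x hxr hxs hxd hK hM
      by_cases hxL : x ∈ L
      · rcases mem_K2_iff.1 hK with h' | h'
        · exact notMem_L_of_conn_restrict hL hr h' hxL
        · exact notMem_L_of_conn_restrict hL hs h' hxL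
      · exact h x hxr hxs hxd ((mem_K2_restrict_iff_of_notMem hL hxL).2 hK)
          ((mem_M2_restrict_iff_of_notMem hL hxL).2 hM)
    · intro x hxL hxd hK hM
      have hxr : x ≠ r := fun h' => hr (h' ▸ hxL)
      have hxs : x ≠ s := fun h' => hs (h' ▸ hxL)
      exact h x hxr hxs hxd ((mem_K2_F_iff_of_mem hL hr hs hxL).2 hK)
        ((mem_M2_F_iff_of_mem hL hr hs hxL).2 hM)
  · rintro ⟨h1, h2⟩ x hxr hxs hxd hK hM
    by_cases hxL : x ∈ L
    · exact h2 x hxL hxd ((mem_K2_F_iff_of_mem hL hr hs hxL).1 hK)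
        ((mem_M2_F_iff_of_mem hL hr hs hxL).1 hM)
    · exact h1 x hxr hxs hxd ((mem_K2_restrict_iff_of_notMem hL hxL).1 hK)
        ((mem_M2_restrict_iff_of_notMem hL hxL).1 hM)

/-- **`Sep ∧ DOne` of the glued colouring, `d` anywhere.** -/
lemma legal_glue_iff' (hL : ∀ e x y, ends e = s(x, y) → x ∈ L → y ∈ L ∨ y = r ∨ y = s)
    (hp : p ∉ L) (hq : q ∉ L) (hr : r ∉ L) (hs : s ∉ L)
    (ω' : {e // e ∉ within ends (L ∪ {r, s} : Set V)} → Bool)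
    (τ : {e // ¬ (e ∉ within ends (L ∪ {r, s} : Set V))} → Bool) :
    (sep2 ends p q r s ((Equiv.piEquivPiSubtypeProd
        (fun e => e ∉ within ends (L ∪ {r, s} : Set V)) (fun _ => Bool)).symm (ω', τ)) ∧
      DOne ends r s d ((Equiv.piEquivPiSubtypeProd
        (fun e => e ∉ within ends (L ∪ {r, s} : Set V)) (fun _ => Bool)).symm (ω', τ))) ↔
    ((sep2 (fun e : {e // e ∉ within ends (L ∪ {r, s} : Set V)} => ends e.1) p q r s ω' ∧
      DOne (fun e : {e // e ∉ within ends (L ∪ {r, s} : Set V)} => ends e.1) r s d ω') ∧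
      ∀ x ∈ L, x ≠ d →
        x ∈ K2 (fun e : {e // ¬ (e ∉ within ends (L ∪ {r, s} : Set V))} => ends e.1) r s τ →
        x ∉ M2 (fun e : {e // ¬ (e ∉ within ends (L ∪ {r, s} : Set V))} => ends e.1) r s τ) := by
  rw [sep2_restrict_iff_rootOnly hL hp hq, DOne_restrict_iff_rootOnly' hL hr hs,
    restrict_glue_rootOnly, restrictF_glue_rootOnly]
  tauto

/-- The admissibility «no vertex of `L` other than `d` in both worlds of the `F`-graph» is
invariant under the colour flip of `τ`. -/
lemma admissible_compl_iff' (τ : {e // ¬ (e ∉ within ends (L ∪ {r, s} : Set V))} → Bool) :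
    (∀ x ∈ L, x ≠ d →
      x ∈ K2 (fun e : {e // ¬ (e ∉ within ends (L ∪ {r, s} : Set V))} => ends e.1) r s
        (OneColourSwitch.compl τ) →
      x ∉ M2 (fun e : {e // ¬ (e ∉ within ends (L ∪ {r, s} : Set V))} => ends e.1) r s
        (OneColourSwitch.compl τ)) ↔
    (∀ x ∈ L, x ≠ d →
      x ∈ K2 (fun e : {e // ¬ (e ∉ within ends (L ∪ {r, s} : Set V))} => ends e.1) r s τ →
      x ∉ M2 (fun e : {e // ¬ (e ∉ within ends (L ∪ {r, s} : Set V))} => ends e.1) r s τ) := by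
  simp only [K2_compl, M2_compl]
  constructor
  · intro h x hx hxd h1 h2
    exact h x hx hxd h2 h1
  · intro h x hx hxd h1 h2
    exact h x hx hxd h2 h1

/-- A vertex with no edge at all lies in no world of `{r, s}` (it is not `r`, `s`). -/
lemma notMem_K2_of_no_edge {ω : Config E} (hd : ∀ e, d ∉ ends e) (hdr : d ≠ r) (hds : d ≠ s) :
    d ∉ K2 ends r s ω := by
  intro h
  have hno : ∀ e, d ∈ ends e → ω e = false := fun e he => (hd e he).elim
  rcases mem_K2_iff.1 h with h' | h'
  · exact hdr (eq_of_conn_of_no_openEdge hno h').symm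
  · exact hds (eq_of_conn_of_no_openEdge hno h').symm

end DAnywhere

section Count

variable [Fintype E] [DecidableEq E]

/-- **The sum over the admissible colourings `τ` of `F` of `σ_rs`, for ANY flip-invariant
admissibility `A`**: `κ · σ_rs` of the restriction, `κ` = the number of admissible `τ` without an
`r`–`s` link in the `F`-graph. -/
lemma sum_sigma_rs_glue_of_compl_iff
    (hL : ∀ e x y, ends e = s(x, y) → x ∈ L → y ∈ L ∨ y = r ∨ y = s) (hr : r ∉ L) (hs : s ∉ L)
    (A : ({e // ¬ (e ∉ within ends (L ∪ {r, s} : Set V))} → Bool) → Prop)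
    (hA : ∀ τ, A (OneColourSwitch.compl τ) ↔ A τ)
    (ω' : {e // e ∉ within ends (L ∪ {r, s} : Set V)} → Bool) :
    (∑ τ : ({e // ¬ (e ∉ within ends (L ∪ {r, s} : Set V))} → Bool),
      if A τ then sigma ends ((Equiv.piEquivPiSubtypeProd
        (fun e => e ∉ within ends (L ∪ {r, s} : Set V)) (fun _ => Bool)).symm (ω', τ)) r s
      else 0) =
    (∑ τ : ({e // ¬ (e ∉ within ends (L ∪ {r, s} : Set V))} → Bool),
      if A τ ∧
        ¬ Conn (fun e : {e // ¬ (e ∉ within ends (L ∪ {r, s} : Set V))} => ends e.1) τ r s then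
        (1 : ℤ) else 0) *
    sigma (fun e : {e // e ∉ within ends (L ∪ {r, s} : Set V)} => ends e.1) ω' r s := by
  -- the summand, written with the two links of the `F`-graph
  have h1 : ∀ τ : ({e // ¬ (e ∉ within ends (L ∪ {r, s} : Set V))} → Bool),
      (if A τ then sigma ends ((Equiv.piEquivPiSubtypeProd
        (fun e => e ∉ within ends (L ∪ {r, s} : Set V)) (fun _ => Bool)).symm (ω', τ)) r s
      else 0) =
      (if A τ ∧
        (Conn (fun e : {e // e ∉ within ends (L ∪ {r, s} : Set V)} => ends e.1) ω' r s ∨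
          Conn (fun e : {e // ¬ (e ∉ within ends (L ∪ {r, s} : Set V))} => ends e.1) τ r s) then
        (1 : ℤ) else 0) -
      (if A τ ∧
        (Conn (fun e : {e // e ∉ within ends (L ∪ {r, s} : Set V)} => ends e.1)
            (OneColourSwitch.compl ω') r s ∨
          Conn (fun e : {e // ¬ (e ∉ within ends (L ∪ {r, s} : Set V))} => ends e.1)
            (OneColourSwitch.compl τ) r s) then (1 : ℤ) else 0) := by
    intro τ
    unfold sigma
    rw [if_congr (conn_rs_glue_iff_rootOnly hL hr hs ω' τ) rfl rfl,
      if_congr (conn_compl_rs_glue_iff_rootOnly hL hr hs ω' τ) rfl rfl]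
    by_cases hAτ : A τ <;>
    by_cases hY : Conn (fun e : {e // e ∉ within ends (L ∪ {r, s} : Set V)} => ends e.1) ω' r s ∨
        Conn (fun e : {e // ¬ (e ∉ within ends (L ∪ {r, s} : Set V))} => ends e.1) τ r s <;>
    by_cases hW : Conn (fun e : {e // e ∉ within ends (L ∪ {r, s} : Set V)} => ends e.1)
        (OneColourSwitch.compl ω') r s ∨
      Conn (fun e : {e // ¬ (e ∉ within ends (L ∪ {r, s} : Set V))} => ends e.1)
        (OneColourSwitch.compl τ) r s <;>
    simp [hAτ, hY, hW]
  -- the `W` count equals the `Y` count by the colour flip of `τ`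
  have h2 : ∑ τ : ({e // ¬ (e ∉ within ends (L ∪ {r, s} : Set V))} → Bool),
      (if A τ ∧
        (Conn (fun e : {e // e ∉ within ends (L ∪ {r, s} : Set V)} => ends e.1)
            (OneColourSwitch.compl ω') r s ∨
          Conn (fun e : {e // ¬ (e ∉ within ends (L ∪ {r, s} : Set V))} => ends e.1)
            (OneColourSwitch.compl τ) r s) then (1 : ℤ) else 0) =
      ∑ τ : ({e // ¬ (e ∉ within ends (L ∪ {r, s} : Set V))} → Bool),
      (if A τ ∧
        (Conn (fun e : {e // e ∉ within ends (L ∪ {r, s} : Set V)} => ends e.1)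
            (OneColourSwitch.compl ω') r s ∨
          Conn (fun e : {e // ¬ (e ∉ within ends (L ∪ {r, s} : Set V))} => ends e.1) τ r s) then
        (1 : ℤ) else 0) := by
    rw [← Equiv.sum_comp (Function.Involutive.toPerm
      (OneColourSwitch.compl (E := {e // ¬ (e ∉ within ends (L ∪ {r, s} : Set V))}))
      OneColourSwitch.compl_compl)]
    refine Finset.sum_congr rfl fun τ _ => ?_
    simp only [Function.Involutive.coe_toPerm, OneColourSwitch.compl_compl]
    exact if_congr (and_congr (hA τ) Iff.rfl) rfl rfl
  rw [Finset.sum_congr rfl fun τ _ => h1 τ, Finset.sum_sub_distrib, h2, ← Finset.sum_sub_distrib,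
    Finset.sum_mul]
  refine Finset.sum_congr rfl fun τ _ => ?_
  unfold sigma
  by_cases hAτ : A τ <;>
  by_cases hF : Conn (fun e : {e // ¬ (e ∉ within ends (L ∪ {r, s} : Set V))} => ends e.1) τ r s <;>
  by_cases hY : Conn (fun e : {e // e ∉ within ends (L ∪ {r, s} : Set V)} => ends e.1) ω' r s <;>
  by_cases hW : Conn (fun e : {e // e ∉ within ends (L ∪ {r, s} : Set V)} => ends e.1)
      (OneColourSwitch.compl ω') r s <;>
  simp [hAτ, hF, hY, hW]

/-- **The single-`d` sign sum of `G` is a non-negative multiple of the one of `G` with the edges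
inside `L ∪ {r, s}` removed — `d` anywhere** (`κ` = the number of colourings of those edges with
no vertex of `L` other than `d` in both worlds of the `F`-graph and no `r`–`s` link through
them). -/
theorem dSignSum_eq_mul_restrict_rootOnly'
    (hL : ∀ e x y, ends e = s(x, y) → x ∈ L → y ∈ L ∨ y = r ∨ y = s)
    (hp : p ∉ L) (hq : q ∉ L) (hr : r ∉ L) (hs : s ∉ L) :
    dSignSum ends p q r s d =
    (∑ τ : ({e // ¬ (e ∉ within ends (L ∪ {r, s} : Set V))} → Bool),
      if (∀ x ∈ L, x ≠ d →
        x ∈ K2 (fun e : {e // ¬ (e ∉ within ends (L ∪ {r, s} : Set V))} => ends e.1) r s τ →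
        x ∉ M2 (fun e : {e // ¬ (e ∉ within ends (L ∪ {r, s} : Set V))} => ends e.1) r s τ) ∧
        ¬ Conn (fun e : {e // ¬ (e ∉ within ends (L ∪ {r, s} : Set V))} => ends e.1) τ r s then
        (1 : ℤ) else 0) *
    dSignSum (fun e : {e // e ∉ within ends (L ∪ {r, s} : Set V)} => ends e.1) p q r s d := by
  unfold dSignSum
  rw [← (Equiv.piEquivPiSubtypeProd (fun e => e ∉ within ends (L ∪ {r, s} : Set V))
    (fun _ => Bool)).symm.sum_comp, Fintype.sum_prod_type, Finset.mul_sum]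
  refine Finset.sum_congr rfl fun ω' _ => ?_
  by_cases h : sep2 (fun e : {e // e ∉ within ends (L ∪ {r, s} : Set V)} => ends e.1) p q r s ω' ∧
      DOne (fun e : {e // e ∉ within ends (L ∪ {r, s} : Set V)} => ends e.1) r s d ω'
  · rw [if_pos h]
    calc ∑ τ : ({e // ¬ (e ∉ within ends (L ∪ {r, s} : Set V))} → Bool),
          (if sep2 ends p q r s ((Equiv.piEquivPiSubtypeProd
              (fun e => e ∉ within ends (L ∪ {r, s} : Set V)) (fun _ => Bool)).symm (ω', τ)) ∧
              DOne ends r s d ((Equiv.piEquivPiSubtypeProd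
              (fun e => e ∉ within ends (L ∪ {r, s} : Set V)) (fun _ => Bool)).symm (ω', τ)) then
            sigma ends ((Equiv.piEquivPiSubtypeProd
              (fun e => e ∉ within ends (L ∪ {r, s} : Set V)) (fun _ => Bool)).symm (ω', τ)) p q *
            sigma ends ((Equiv.piEquivPiSubtypeProd
              (fun e => e ∉ within ends (L ∪ {r, s} : Set V)) (fun _ => Bool)).symm (ω', τ)) r s
          else 0)
        = ∑ τ : ({e // ¬ (e ∉ within ends (L ∪ {r, s} : Set V))} → Bool),
          sigma (fun e : {e // e ∉ within ends (L ∪ {r, s} : Set V)} => ends e.1) ω' p q *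
          (if (∀ x ∈ L, x ≠ d →
              x ∈ K2 (fun e : {e // ¬ (e ∉ within ends (L ∪ {r, s} : Set V))} => ends e.1) r s
                τ →
              x ∉ M2 (fun e : {e // ¬ (e ∉ within ends (L ∪ {r, s} : Set V))} => ends e.1) r s
                τ)
          then sigma ends ((Equiv.piEquivPiSubtypeProd
              (fun e => e ∉ within ends (L ∪ {r, s} : Set V)) (fun _ => Bool)).symm (ω', τ)) r s
          else 0) := by
          refine Finset.sum_congr rfl fun τ _ => ?_
          by_cases hA : ∀ x ∈ L, x ≠ d →
              x ∈ K2 (fun e : {e // ¬ (e ∉ within ends (L ∪ {r, s} : Set V))} => ends e.1) r s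
                τ →
              x ∉ M2 (fun e : {e // ¬ (e ∉ within ends (L ∪ {r, s} : Set V))} => ends e.1) r s τ
          · have hg := (legal_glue_iff' hL hp hq hr hs ω' τ).2 ⟨h, hA⟩
            rw [if_pos hg, if_pos hA, sigma_pq_glue_eq_rootOnly hL hp ω' τ hg.1]
          · rw [if_neg (fun hg => hA ((legal_glue_iff' hL hp hq hr hs ω' τ).1 hg).2), if_neg hA,
              mul_zero]
      _ = sigma (fun e : {e // e ∉ within ends (L ∪ {r, s} : Set V)} => ends e.1) ω' p q *
          ∑ τ : ({e // ¬ (e ∉ within ends (L ∪ {r, s} : Set V))} → Bool),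
          (if (∀ x ∈ L, x ≠ d →
              x ∈ K2 (fun e : {e // ¬ (e ∉ within ends (L ∪ {r, s} : Set V))} => ends e.1) r s
                τ →
              x ∉ M2 (fun e : {e // ¬ (e ∉ within ends (L ∪ {r, s} : Set V))} => ends e.1) r s
                τ)
          then sigma ends ((Equiv.piEquivPiSubtypeProd
              (fun e => e ∉ within ends (L ∪ {r, s} : Set V)) (fun _ => Bool)).symm (ω', τ)) r s
          else 0) := by rw [Finset.mul_sum]
      _ = _ := by
          rw [sum_sigma_rs_glue_of_compl_iff hL hr hs _ (fun τ => admissible_compl_iff' τ)]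
          ring
  · rw [if_neg h, mul_zero]
    refine Finset.sum_eq_zero fun τ _ => ?_
    rw [if_neg (fun hg => h ((legal_glue_iff' hL hp hq hr hs ω' τ).1 hg).1)]

end Count

section Isolated

variable [Fintype V] [DecidableEq V] [Fintype E] [DecidableEq E]

omit [Fintype V] [DecidableEq V] in
/-- **An isolated `d` is never reached**: the single-`d` sum is its unreached part. -/
lemma dSignSum_eq_unreachedSum_of_isolated (hd : ∀ e, d ∉ ends e) (hdr : d ≠ r) (hds : d ≠ s) :
    dSignSum ends p q r s d = unreachedSum ends p q r s d := by
  unfold dSignSum unreachedSum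
  refine Finset.sum_congr rfl fun ω _ => ?_
  by_cases h : sep2 ends p q r s ω ∧ DOne ends r s d ω
  · rw [if_pos h, if_pos ⟨h.1, h.2, notMem_K2_of_no_edge hd hdr hds,
      notMem_K2_of_no_edge (ω := OneColourSwitch.compl ω) hd hdr hds⟩]
  · rw [if_neg h, if_neg (fun h' => h ⟨h'.1, h'.2.1⟩)]

/-- **`{r, s}` separates `d` from `{p, q}` ⇒ `dSignSum ≤ 0`**: for a vertex set `L ∋ d` with
`p, q, r, s ∉ L` that is closed under adjacency except through `r` and `s`, the single-`d` sign
sum is non-positive — no hypothesis on the structure of `L` (linking free blocks, pockets,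
`T`-edges, edges inside `{r, s}` arbitrary) nor on the rest of the graph. -/
theorem dSignSum_nonpos_of_rootOnly_mem
    (hL : ∀ e x y, ends e = s(x, y) → x ∈ L → y ∈ L ∨ y = r ∨ y = s)
    (hp : p ∉ L) (hq : q ∉ L) (hr : r ∉ L) (hs : s ∉ L) (hd : d ∈ L) :
    dSignSum ends p q r s d ≤ 0 := by
  have hdr : d ≠ r := fun h => hr (h ▸ hd)
  have hds : d ≠ s := fun h => hs (h ▸ hd)
  rw [dSignSum_eq_mul_restrict_rootOnly' hL hp hq hr hs]
  refine mul_nonpos_iff.2 (Or.inl ⟨Finset.sum_nonneg fun τ _ => by split_ifs <;> norm_num, ?_⟩)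
  -- in `G − F` the vertex `d` is isolated: every edge at `d` lies inside `L ∪ {r, s}`
  have hiso : ∀ e : {e // e ∉ within ends (L ∪ {r, s} : Set V)}, d ∉ ends e.1 := by
    intro e he
    obtain ⟨y, hy⟩ := Sym2.mem_iff_exists.1 he
    exact e.2 (mem_within_of_mem_L hL hy hd)
  rw [dSignSum_eq_unreachedSum_of_isolated hiso hdr hds]
  exact unreachedSum_nonpos

end Isolated

end NoPocket

end Summit.Ventures.PercRepro2
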